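import Summits.BirchSwinnertonDyer.BirchSwinnertonDyer.Theorems.CMKolyvaginAtInertTwoCebotarevLeafAtTwoPow
import Summits.BirchSwinnertonDyer.BirchSwinnertonDyer.Theorems.CMKolyvaginAtInertTwoRegularTorsionAtTwo
import Summits.BirchSwinnertonDyer.BirchSwinnertonDyer.Theorems.CMKolyvaginAtInertTwoTranspositionAtTwo
import Summits.BirchSwinnertonDyer.BirchSwinnertonDyer.Theorems.CMKolyvaginAtInertTwoKolyvaginPrimeInertAtTwo
import Summits.BirchSwinnertonDyer.BirchSwinnertonDyer.Theorems.GenusKolyvaginAtTwoPowDvdShaCardAtTwoRTFullOrderPairChebotarev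
import Summits.BirchSwinnertonDyer.Rank1Residual.P2.CMKolyvaginCartanCommuteAtTwoClasses
import Literature.NumberTheory.EllipticCurves.McCallum1991.EigenclassesCebotarevLevelPow
import Literature.NumberTheory.Automorphic.ChebotarevArtinRepHolds
import HarnessLib

/-!
# Route `CMKolyvaginAtInertTwo`, crux `CMKolyvaginExactAtInertTwo` (stmt-BirchSwinnertonDyer-24277):
# THE FULL-ORDER PAIR ČEBOTAREV AT `2` ON THE CM-INERT HABITAT — two eigenclasses of `H¹(K, E[2^M])`
# given FULL local order at infinitely many Kolyvagin primes of depth `M`, WITHOUT `ρ_{E,2^∞} = GL₂(ℤ₂)`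

Seat `bsd-line-cmk2-p1` g16 (cell `bsd-print-cf2`); helper (`--supports stmt-BirchSwinnertonDyer-24277`).
THEOREMS ONLY: no definition, no named fact, no `sorry`; no item is closed; BSD is not proved by this.

WHY. The lower half of the crux ("`2^{2M₀} ∣ #Ш`", McCallum 1991 Prop. 5.2 / Thm. 5.4 "≥") is being
assembled by the `GenusKolyvaginAtTwo` seats as LINE 18 `plus_descent` of their crux
`PowDvdShaCardAtTwoRT` (stmt-23242) for NON-CM curves with `ρ_{E,2^∞}` onto `GL₂(ℤ₂)`; on the generic
genus budget `δ = 1` — which is the whole CM-inert habitat `H₂` with prime `|d_K|` — that line is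
complete modulo assembly (their memo `Cruxes/PowDvdShaCardAtTwoRT/Lines/plus-descent-lead-g16.md`).
Every swap / bottom-rung engine there prescribes FULL local orders of TWO classes at one new
Kolyvagin prime through the socket
`GenusExact.PlusDescent.infinite_kolyvaginPrime_localization_fullOrder_pair` (p693079), whose
hypotheses `¬ W.HasCM` and `∀ n, ρ̄_{E,2^n} onto` FAIL on `H₂` (CM; the `2`-adic image is the
normaliser of the non-split Cartan). This file is the SAME SOCKET on `H₂`:

* `exists_kolyvaginPrime_gt_fullOrder_pair_two_pow` — for `W/ℚ` with `ρ̄_{W,2}` onto and `Δ_W < 0`,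
  `K` imaginary quadratic with `Δ_W ∉ K²` and conjugation `c ≠ 1`, a Cartan-type `z ∈ Γ_K` (no fixed
  point on `E[2] ∖ 0`, commuting on `E[2^M]` with `Γ_{K(E[2])}` — the route's `𝔽₄ˣ` lever, binders
  `hzfix`/`hcomm` of the level-`2^M` Čebotarev leaf), `M ≥ 1`, and two eigenclasses
  `x, y ∈ H¹(K, E[2^M])` (`c_* x = ±x`, `c_* y = ±y`, ANY signs) of orders `2^m`, `2^κ` (`m, κ ≥ 1`):
  for every `b` a prime `ℓ > b`, `ℓ ∤ 2 N d_K`, `(ℓ)` prime in `𝓞_K`, `Frob(ℓ) = Frob(∞)` on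
  `K(E[2^M])`, at whose place `ord x_λ = 2^m` AND `ord y_λ = 2^κ`
  (`2^j x ∈ torsionLocalKer_λ ⟺ m ≤ j`, same for `y`). NO separation hypothesis (`hres` of p693079):
  the restriction to `Γ_{K(E[2^M])}` is injective on all of `H¹(K, E[2^M])` under `hcomm` (g7).
  PROOF = gk2-p2 g16's socle dichotomy run on cmk2 g7's leaf
  `KolyvaginImageTwo.exists_kolyvaginPrime_gt_two_pow_of_targets`: distinct socles ⟹ `{x, y}` independent
  (`PlusDescent.dvd_of_zsmul_add_zsmul_eq_zero_of_socle_ne`), targets `t = 2^{M−e}·m₀` with `m₀` the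
  regular vector of `…KolyvaginPairDataTwo.exists_regular_torsion_of_Δ_neg` (so `[x, F] = 2^{M−m}(m₀ ± τm₀)`
  has order exactly `2^m`); equal socles ⟹ prescribe `x` alone and transport full order to `y`
  through the common socle (`PlusDescent.pow_zsmul_mem_iff_of_socle_not_mem`).
* `infinite_kolyvaginPrime_localization_fullOrder_pair_of_cmInert` — **ON `H₂`, UNCONDITIONALLY**
  (`W` globally minimal with CM, `CMInert W 2`, `ρ̄_{W,2}` onto; `K` imaginary quadratic with the Heegner
  hypothesis for `N_E`): the conclusion of p693079 VERBATIM (`Set.Infinite {ℓ | FrobEqFrobInfty W K (2^M) ℓ ∧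
  Zhang2014.IsKolyvaginPrime N_E W K 2 ℓ ∧ M ≤ kolyvaginIndex W 2 ℓ ∧ ∀ v ∋ ℓ, …}`) AND `CMInert W ℓ`
  (the produced primes are inert in `F`, as the route's point systems require) — Čebotarev
  (`chebotarev_artinRep_holds`), the Cartan element (`exists_smul_three_of_hasSurjectiveModNGaloisRep`,
  ty2's `CartanAtTwo.hcomm_of_habitat`), `Δ < 0`, `Δ ∉ K²` and inertness in `F`
  (`cmInert_of_isKolyvaginPrime_two`) all being theorems of the tree on `H₂`.

References: [McCallumLMS1991] §3 Prop. 3.1, (2), (3), Cor. 3.2; §5 proof of Prop. 5.2 ((11)–(13));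
[GrossLMS1991] §9 Props. 9.1, 9.3; (3.1)–(3.3).
-/

-- single-conjunct summit: `Summit.BirchSwinnertonDyer.BirchSwinnertonDyer.…` repeats the name by design
set_option linter.dupNamespace false
set_option autoImplicit false

noncomputable section

open scoped Classical
open WeierstrassCurve NumberField IsDedekindDomain Field
open Literature.NumberTheory.GaloisRepresentations Literature.NumberTheory.EllipticCurves
open Summit.BirchSwinnertonDyer.BirchSwinnertonDyer.Theorems.GenusExact.PlusDescent
  (dvd_of_zsmul_add_zsmul_eq_zero_of_socle_ne ne_zero_of_addOrderOf_eq_two_pow pow_zsmul_mem_iff_of_socle_not_mem)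

namespace Summit.BirchSwinnertonDyer.BirchSwinnertonDyer.Theorems.KolyvaginImageTwo

section General

variable {N : ℕ} [NeZero N] (W : WeierstrassCurve ℚ) [W.IsElliptic] {K : Type} [Field K] [NumberField K]

/-- Order bookkeeping: if `k • w = 0 ⟹ 2^M ∣ k` and `2^M • w = 0`, then for `e ≤ M` the element
`u = 2^{M−e} • w` satisfies `2^j • u = 0 ↔ e ≤ j`. [folklore] -/
private theorem pow_zsmul_pow_zsmul_eq_zero_iff {A : Type*} [AddCommGroup A] {w : A} {M e : ℕ}
    (he : e ≤ M) (hw : ∀ k : ℤ, k • w = 0 → ((2 ^ M : ℕ) : ℤ) ∣ k) (hw0 : ((2 ^ M : ℕ) : ℤ) • w = 0)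
    (j : ℕ) : ((2 ^ j : ℕ) : ℤ) • ((((2 : ℕ) : ℤ) ^ (M - e)) • w) = 0 ↔ e ≤ j := by
  rw [← mul_zsmul]
  constructor
  · intro h
    have hd := hw _ h
    have h2 : ((2 ^ j : ℕ) : ℤ) * ((2 : ℕ) : ℤ) ^ (M - e) = ((2 ^ (j + (M - e)) : ℕ) : ℤ) := by
      push_cast; ring
    rw [h2, Int.natCast_dvd_natCast] at hd
    have := (Nat.pow_dvd_pow_iff_le_right (by norm_num : 1 < 2)).mp hd
    omega
  · intro h
    have h2 : ((2 ^ j : ℕ) : ℤ) * ((2 : ℕ) : ℤ) ^ (M - e) = ((2 ^ (j - e) : ℕ) : ℤ) * ((2 ^ M : ℕ) : ℤ) := by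
      push_cast
      rw [← pow_add, ← pow_add]
      congr 1
      omega
    rw [h2, mul_zsmul, hw0, zsmul_zero]

/-- `addOrderOf x = 2^m` for a class killed by `2^M` forces `m ≤ M` and `(2:ℤ)^m • x = 0`. [folklore] -/
private theorem le_and_pow_zsmul_eq_zero_of_addOrderOf {A : Type*} [AddCommGroup A] {x : A} {M m : ℕ}
    (hx : addOrderOf x = 2 ^ m) (hM : ((2 ^ M : ℕ) : ℤ) • x = 0) :
    m ≤ M ∧ (((2 : ℕ) : ℤ) ^ m) • x = 0 := by
  refine ⟨?_, ?_⟩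
  · have hd : addOrderOf x ∣ 2 ^ M := by
      rw [addOrderOf_dvd_iff_nsmul_eq_zero, ← natCast_zsmul]; exact hM
    rw [hx] at hd
    exact (Nat.pow_dvd_pow_iff_le_right (by norm_num : 1 < 2)).mp hd
  · have : ((2 ^ m : ℕ) : ℤ) • x = 0 := by
      rw [natCast_zsmul, ← hx]; exact addOrderOf_nsmul_eq_zero x
    push_cast at this
    exact this

/-- **The full-order PAIR Čebotarev at `2` for CM-admissible images (Cartan binder form).** `W/ℚ`
with `ρ̄_{W,2}` onto and `Δ_W < 0`; `K` imaginary quadratic with `Δ_W ∉ K²`, `c ≠ 1` its conjugation;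
`M ≥ 1`; `z ∈ Γ_K` without non-zero fixed point on `E[2]`, commuting on `E[2^M]` with `Γ_{K(E[2])}`;
`x, y ∈ H¹(K, E[2^M])` eigenclasses of `c_*` (signs `sx, sy = ±1`) of orders `2^m`, `2^κ`, `m, κ ≥ 1`.
Then for every `b` there is a prime `ℓ > b` with `ℓ ∤ N`, `ℓ ∤ d_K`, `ℓ ≠ 2`, `(ℓ)` prime in `𝓞_K`,
`Frob(ℓ) = Frob(∞)` on `K(E[2^M])`, such that at every place `v ∋ ℓ` of `K`:
`2^j x ∈ torsionLocalKer_v ↔ m ≤ j` and `2^j y ∈ torsionLocalKer_v ↔ κ ≤ j` (both classes keep their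
full order locally). Conditional only on the displayed Čebotarev fact `hC` (discharged in the tree).
[cite: McCallumLMS1991, §3 Prop. 3.1, (2), (3), Cor. 3.2; §5 proof of Prop. 5.2 ((11)–(12))]
[cite: GrossLMS1991, §9 Props. 9.1, 9.3] -/
theorem exists_kolyvaginPrime_gt_fullOrder_pair_two_pow
    (hC : Literature.NumberTheory.Automorphic.chebotarev_artinRep)
    (hK : IsImaginaryQuadratic K) (hρ : W.HasSurjectiveModNGaloisRep 2) (hΔ : W.Δ < 0)
    (hΔK : ¬ IsSquare (W.baseChange K).Δ) {c : K ≃ₐ[ℚ] K} (hc : c ≠ 1)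
    {M : ℕ} (hM : 1 ≤ M) {z : absoluteGaloisGroup K}
    (hzfix : ∀ P : geomTorsion (W.baseChange K) ((2 : ℕ) : ℤ), z • P = P → P = 0)
    (hcomm : ∀ π ∈ torsionFixing (W.baseChange K) ((2 : ℕ) : ℤ),
      ∀ P : geomTorsion (W.baseChange K) ((2 ^ M : ℕ) : ℤ), π • z • P = z • π • P)
    (x y : galH1Torsion (W.baseChange K) ((2 ^ M : ℕ) : ℤ))
    {m κ : ℕ} (hm : 1 ≤ m) (hκ : 1 ≤ κ) (hx : addOrderOf x = 2 ^ m) (hy : addOrderOf y = 2 ^ κ)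
    {sx sy : ℤ} (hsx : sx = 1 ∨ sx = -1) (hsy : sy = 1 ∨ sy = -1)
    (hτx : conjAct W c ((2 ^ M : ℕ) : ℤ) x = sx • x) (hτy : conjAct W c ((2 ^ M : ℕ) : ℤ) y = sy • y)
    (b : ℕ) :
    ∃ ℓ : ℕ, b < ℓ ∧ ℓ.Prime ∧ ¬ ℓ ∣ N ∧ ¬ ((ℓ : ℤ) ∣ NumberField.discr K) ∧ ℓ ≠ 2 ∧
      (Ideal.span {(ℓ : 𝓞 K)}).IsPrime ∧ FrobEqFrobInfty W K (2 ^ M) ℓ ∧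
      ∀ v : HeightOneSpectrum (𝓞 K), (ℓ : 𝓞 K) ∈ v.asIdeal →
        (∀ j : ℕ, ((2 ^ j : ℕ) : ℤ) • x ∈
            (W.baseChange K).torsionLocalKer (v.adicCompletion K) ((2 ^ M : ℕ) : ℤ) ↔ m ≤ j) ∧
        ∀ j : ℕ, ((2 ^ j : ℕ) : ℤ) • y ∈
            (W.baseChange K).torsionLocalKer (v.adicCompletion K) ((2 ^ M : ℕ) : ℤ) ↔ κ ≤ j := by
  -- ### a complex conjugation `c₀ ∈ Γ_ℚ`, the transported involution `τ`, and a regular vector `m₀`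
  obtain ⟨c₀, hc₀⟩ := exists_isComplexConjugation (Rat.castHom ℝ)
  set ht := RatClosure.isLiftOfAut_absGaloisTransport_of_isImaginaryQuadratic hK hc hc₀
  obtain ⟨m₀, hm₀⟩ := KolyvaginPairDataTwo.exists_regular_torsion_of_Δ_neg W hK hΔ hc hc₀ hM
  -- orders
  have hxM : ((2 ^ M : ℕ) : ℤ) • x = 0 := zsmul_galH1Torsion_eq_zero (W.baseChange K) _ x
  have hyM : ((2 ^ M : ℕ) : ℤ) • y = 0 := zsmul_galH1Torsion_eq_zero (W.baseChange K) _ y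
  obtain ⟨hmM, hxm⟩ := le_and_pow_zsmul_eq_zero_of_addOrderOf hx hxM
  obtain ⟨hκM, hyκ⟩ := le_and_pow_zsmul_eq_zero_of_addOrderOf hy hyM
  have hm₀M : ((2 ^ M : ℕ) : ℤ) • m₀ = 0 := by
    have := AddSubgroup.torsionBy.nsmul m₀
    rwa [← natCast_zsmul] at this
  -- the regular vectors `w_s = m₀ + s • τ m₀` (order exactly `2^M`) and the targets `2^{M-e} • m₀`
  have hws : ∀ s : ℤ, s = 1 ∨ s = -1 → ∀ e : ℕ, e ≤ M → ∀ j : ℕ,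
      ((2 ^ j : ℕ) : ℤ) • (s • ht.torsionMap W ((2 ^ M : ℕ) : ℤ) ((((2 : ℕ) : ℤ) ^ (M - e)) • m₀) +
        (((2 : ℕ) : ℤ) ^ (M - e)) • m₀) = 0 ↔ e ≤ j := by
    intro s hs e he j
    have hw0 : ((2 ^ M : ℕ) : ℤ) • (m₀ + s • ht.torsionMap W ((2 ^ M : ℕ) : ℤ) m₀) = 0 := by
      have := AddSubgroup.torsionBy.nsmul (m₀ + s • ht.torsionMap W ((2 ^ M : ℕ) : ℤ) m₀)
      rwa [← natCast_zsmul] at this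
    have key := pow_zsmul_pow_zsmul_eq_zero_iff he (hm₀ s hs) hw0 j
    have heq : s • ht.torsionMap W ((2 ^ M : ℕ) : ℤ) ((((2 : ℕ) : ℤ) ^ (M - e)) • m₀) +
        (((2 : ℕ) : ℤ) ^ (M - e)) • m₀ =
        (((2 : ℕ) : ℤ) ^ (M - e)) • (m₀ + s • ht.torsionMap W ((2 ^ M : ℕ) : ℤ) m₀) := by
      rw [map_zsmul, zsmul_add, ← mul_zsmul, ← mul_zsmul, mul_comm, add_comm]
    rw [heq]
    exact key
  -- ### the socle dichotomy
  by_cases hsoc : 2 ^ (m - 1) • x = 2 ^ (κ - 1) • y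
  · -- equal socles: prescribe `x` alone (family of one class)
    obtain ⟨ℓ, hbℓ, hℓ, hℓN, hℓD, hℓ2, hprime, hfrob, F, hF, hval, hloc⟩ :=
      exists_kolyvaginPrime_gt_two_pow_of_targets hC (N := N) W hK hρ hΔK hc hc₀ hM hzfix hcomm
        ![x] id ![sx] (fun i ↦ by fin_cases i; simpa using hτx) ![m]
        (fun i ↦ by fin_cases i; simpa using hxm)
        (fun a ha i ↦ by
          fin_cases i
          simp only [Fin.sum_univ_one, Fin.isValue, Matrix.cons_val_zero] at ha
          have hd : ((addOrderOf x : ℕ) : ℤ) ∣ a 0 := by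
            rw [addOrderOf_dvd_iff_zsmul_eq_zero]; exact ha
          rw [hx] at hd
          push_cast at hd
          simpa using hd)
        ![(((2 : ℕ) : ℤ) ^ (M - m)) • m₀]
        (fun i ↦ by
          fin_cases i
          show (((2 : ℕ) : ℤ) ^ m) • ((((2 : ℕ) : ℤ) ^ (M - m)) • m₀) = 0
          rw [← mul_zsmul, ← pow_add, Nat.add_sub_cancel' hmM]
          have := hm₀M
          push_cast at this ⊢
          exact this) b
    refine ⟨ℓ, hbℓ, hℓ, hℓN, hℓD, hℓ2, hprime, hfrob, fun v hv ↦ ?_⟩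
    have hxmem : x ∈ AddSubgroup.closure (Set.range ![x]) :=
      AddSubgroup.subset_closure ⟨0, rfl⟩
    have hxv : ∀ j : ℕ, ((2 ^ j : ℕ) : ℤ) • x ∈
        (W.baseChange K).torsionLocalKer (v.adicCompletion K) ((2 ^ M : ℕ) : ℤ) ↔ m ≤ j := by
      intro j
      rw [hloc _ (AddSubgroup.zsmul_mem _ hxmem _) v hv, h1Eval_zsmul _ _ _ _ hF]
      have h0 := hval 0
      simp only [Fin.isValue, Matrix.cons_val_zero, id] at h0
      rw [h0]
      exact hws sx hsx m hmM j
    refine ⟨hxv, pow_zsmul_mem_iff_of_socle_not_mem _ hκ hy ?_⟩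
    -- the common socle `2^{κ-1} y = 2^{m-1} x` is not in the local kernel
    rw [natCast_zsmul, ← hsoc, ← natCast_zsmul]
    intro hmem
    have := (hxv (m - 1)).mp hmem
    omega
  · -- distinct socles: the independent pair `{x, y}`
    obtain ⟨ℓ, hbℓ, hℓ, hℓN, hℓD, hℓ2, hprime, hfrob, F, hF, hval, hloc⟩ :=
      exists_kolyvaginPrime_gt_two_pow_of_targets hC (N := N) W hK hρ hΔK hc hc₀ hM hzfix hcomm
        ![x, y] id ![sx, sy]
        (fun i ↦ by
          fin_cases i
          · simpa using hτx
          · simpa using hτy)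
        ![m, κ]
        (fun i ↦ by
          fin_cases i
          · simpa using hxm
          · simpa using hyκ)
        (fun a ha i ↦ by
          simp only [Fin.sum_univ_two, Fin.isValue, Matrix.cons_val_zero, Matrix.cons_val_one] at ha
          obtain ⟨h0, h1⟩ := dvd_of_zsmul_add_zsmul_eq_zero_of_socle_ne hm hκ hx hy hsoc ha
          fin_cases i
          · push_cast at h0; simpa using h0
          · push_cast at h1; simpa using h1)
        ![(((2 : ℕ) : ℤ) ^ (M - m)) • m₀, (((2 : ℕ) : ℤ) ^ (M - κ)) • m₀]
        (fun i ↦ by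
          fin_cases i
          · show (((2 : ℕ) : ℤ) ^ m) • ((((2 : ℕ) : ℤ) ^ (M - m)) • m₀) = 0
            rw [← mul_zsmul, ← pow_add, Nat.add_sub_cancel' hmM]
            have := hm₀M
            push_cast at this ⊢
            exact this
          · show (((2 : ℕ) : ℤ) ^ κ) • ((((2 : ℕ) : ℤ) ^ (M - κ)) • m₀) = 0
            rw [← mul_zsmul, ← pow_add, Nat.add_sub_cancel' hκM]
            have := hm₀M
            push_cast at this ⊢
            exact this) b
    refine ⟨ℓ, hbℓ, hℓ, hℓN, hℓD, hℓ2, hprime, hfrob, fun v hv ↦ ⟨fun j ↦ ?_, fun j ↦ ?_⟩⟩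
    · have hxmem : x ∈ AddSubgroup.closure (Set.range ![x, y]) :=
        AddSubgroup.subset_closure ⟨0, rfl⟩
      rw [hloc _ (AddSubgroup.zsmul_mem _ hxmem _) v hv, h1Eval_zsmul _ _ _ _ hF]
      have h0 := hval 0
      simp only [Fin.isValue, Matrix.cons_val_zero, id] at h0
      rw [h0]
      exact hws sx hsx m hmM j
    · have hymem : y ∈ AddSubgroup.closure (Set.range ![x, y]) :=
        AddSubgroup.subset_closure ⟨1, rfl⟩
      rw [hloc _ (AddSubgroup.zsmul_mem _ hymem _) v hv, h1Eval_zsmul _ _ _ _ hF]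
      have h1 := hval 1
      simp only [Fin.isValue, Matrix.cons_val_one, Matrix.cons_val_zero, id] at h1
      rw [h1]
      exact hws sy hsy κ hκM j

end General

/-! ## On the habitat `H₂`: the socket of `PlusDescent.infinite_kolyvaginPrime_localization_fullOrder_pair` -/

section Habitat

variable (W : WeierstrassCurve ℚ) [W.IsElliptic] [W.IsGloballyMinimal] [NeZero (W.conductorNorm ℤ)]
  (K : Type) [Field K] [NumberField K]

/-- **THE FULL-ORDER PAIR ČEBOTAREV AT `2` ON `H₂`, unconditional.** `W/ℚ` globally minimal with
CM, `2` inert in the CM field (`CMInert W 2`), `ρ̄_{W,2}` onto; `K` imaginary quadratic satisfying the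
Heegner hypothesis for `N_E`, `c ≠ 1` its conjugation; `M ≥ 1`; `x, y ∈ H¹(K, E[2^M])` eigenclasses
(`c_* x = ±x`, `c_* y = ±y`, any signs) of orders `2^m`, `2^κ` (`m, κ ≥ 1`). Then there are
infinitely many primes `ℓ` with `Frob(ℓ) = Frob(∞)` on `K(E[2^M])`, Kolyvagin primes at `2` in
Zhang's sense for `N_E` of index `M(ℓ) ≥ M`, INERT IN THE CM FIELD (`CMInert W ℓ`), at whose place
`x` has local order exactly `2^m` and `y` exactly `2^κ`
(`2^j·x ∈ torsionLocalKer_λ ⟺ m ≤ j`, `2^j·y ∈ torsionLocalKer_λ ⟺ κ ≤ j`). This is the conclusion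
of `GenusExact.PlusDescent.infinite_kolyvaginPrime_localization_fullOrder_pair` (non-CM,
`ρ_{E,2^∞} = GL₂(ℤ₂)`) on the CM-inert habitat, with the extra conjunct `CMInert W ℓ` and WITHOUT
its separation hypothesis `hres`. Inputs, all theorems of the tree: Čebotarev
(`chebotarev_artinRep_holds`), the order-`3` Cartan element (`exists_smul_three_of_hasSurjectiveModNGaloisRep`)
with `CartanAtTwo.hcomm_of_habitat`, `Δ < 0` (`Δ_neg_of_cmInert_two`), `Δ ∉ K²`
(`not_isSquare_algebraMap_Δ_of_cmInert_two_of_heegner`), Zhang's index from `Frob(ℓ) = Frob(∞)`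
(`McCallum1991.le_kolyvaginIndex_of_frobEqFrobInfty`), inertness in `F`
(`cmInert_of_isKolyvaginPrime_two`). [cite: McCallumLMS1991, §3 Cor. 3.2; §5 proof of Prop. 5.2]
[cite: GrossLMS1991, §3 (3.1)–(3.3), §9 Props. 9.1, 9.3] -/
theorem infinite_kolyvaginPrime_localization_fullOrder_pair_of_cmInert (hCM : W.HasCM)
    (hin : Literature.NumberTheory.EllipticCurves.Rank1Residual.CMInert W 2)
    (hρ : W.HasSurjectiveModNGaloisRep 2) (hK : IsImaginaryQuadratic K)
    (hH : SatisfiesHeegnerHypothesis (W.conductorNorm ℤ) K) (c : K ≃ₐ[ℚ] K) (hc : c ≠ 1)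
    (M : ℕ) (hM : 1 ≤ M) (x y : galH1Torsion (W.baseChange K) ((2 ^ M : ℕ) : ℤ))
    {m κ : ℕ} (hm : 1 ≤ m) (hκ : 1 ≤ κ) (hx : addOrderOf x = 2 ^ m) (hy : addOrderOf y = 2 ^ κ)
    {sx sy : ℤ} (hsx : sx = 1 ∨ sx = -1) (hsy : sy = 1 ∨ sy = -1)
    (hτx : conjAct W c ((2 ^ M : ℕ) : ℤ) x = sx • x) (hτy : conjAct W c ((2 ^ M : ℕ) : ℤ) y = sy • y) :
    Set.Infinite {ℓ : ℕ | FrobEqFrobInfty W K (2 ^ M) ℓ ∧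
      Zhang2014.IsKolyvaginPrime (W.conductorNorm ℤ) W K 2 ℓ ∧ M ≤ Zhang2014.kolyvaginIndex W 2 ℓ ∧
      Literature.NumberTheory.EllipticCurves.Rank1Residual.CMInert W ℓ ∧
      ∀ v : HeightOneSpectrum (𝓞 K), (ℓ : 𝓞 K) ∈ v.asIdeal →
        (∀ j : ℕ, ((2 ^ j : ℕ) : ℤ) • x ∈
            (W.baseChange K).torsionLocalKer (v.adicCompletion K) ((2 ^ M : ℕ) : ℤ) ↔ m ≤ j) ∧
        ∀ j : ℕ, ((2 ^ j : ℕ) : ℤ) • y ∈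
            (W.baseChange K).torsionLocalKer (v.adicCompletion K) ((2 ^ M : ℕ) : ℤ) ↔ κ ≤ j} := by
  haveI : Fact (Nat.Prime 2) := ⟨Nat.prime_two⟩
  -- ### the habitat inputs
  have hΔ : W.Δ < 0 := KolyvaginEigenTwo.Δ_neg_of_cmInert_two W hCM hin hρ
  have hΔK : ¬ IsSquare (W.baseChange K).Δ := by
    have h : (W.baseChange K).Δ = algebraMap ℚ K W.Δ := by rw [baseChange, map_Δ]
    rw [h]
    exact not_isSquare_algebraMap_Δ_of_cmInert_two_of_heegner W hCM hin hρ K hK hH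
  obtain ⟨z, -, hzfix⟩ := exists_smul_three_of_hasSurjectiveModNGaloisRep W K hK.1 hρ
  have hcomm : ∀ π ∈ torsionFixing (W.baseChange K) ((2 : ℕ) : ℤ),
      ∀ P : geomTorsion (W.baseChange K) ((2 ^ M : ℕ) : ℤ), π • z • P = z • π • P :=
    Summit.BirchSwinnertonDyer.Rank1Residual.P2.CartanAtTwo.hcomm_of_habitat W K hCM hin hρ hzfix
  have h2M : 2 ∣ 2 ^ M := dvd_pow_self 2 (by omega)
  -- ### infinitely many primes: one above every bound
  refine Set.infinite_of_forall_exists_gt fun b ↦ ?_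
  obtain ⟨ℓ, hbℓ, hℓ, hℓN, hℓD, hℓ2, hprime, hfrob, hloc⟩ :=
    exists_kolyvaginPrime_gt_fullOrder_pair_two_pow (N := W.conductorNorm ℤ) W
      Literature.NumberTheory.Automorphic.chebotarev_artinRep_holds hK hρ hΔ hΔK hc hM hzfix hcomm
      x y hm hκ hx hy hsx hsy hτx hτy b
  have hidx : M ≤ Zhang2014.kolyvaginIndex W 2 ℓ :=
    McCallum1991.le_kolyvaginIndex_of_frobEqFrobInfty W K Nat.prime_two hM hℓ hℓ2 hℓN hfrob
  have hZ : Zhang2014.IsKolyvaginPrime (W.conductorNorm ℤ) W K 2 ℓ :=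
    ⟨hℓ, hℓN, hℓD, hℓ2, hprime, lt_of_lt_of_le (by omega) hidx⟩
  have hG : IsKolyvaginPrime (W.conductorNorm ℤ) W K 2 ℓ :=
    ⟨hℓ, hℓN, hℓD, hℓ2, hprime, FrobEqFrobInfty.of_dvd (W := W) (K := K) h2M hfrob⟩
  have hF : Literature.NumberTheory.EllipticCurves.Rank1Residual.CMInert W ℓ :=
    KolyvaginDescentTwo.cmInert_of_isKolyvaginPrime_two W hCM hin hρ hG
  exact ⟨ℓ, ⟨hfrob, hZ, hidx, hF, hloc⟩, hbℓ⟩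

/-- **The socket VERBATIM**: the conclusion of
`GenusExact.PlusDescent.infinite_kolyvaginPrime_localization_fullOrder_pair` (at `N = N_E`) on `H₂`,
dropping the conjunct `CMInert W ℓ` of the previous theorem — so that the `plus_descent` engines of
the `GenusKolyvaginAtTwo` lower half port to the CM-inert habitat by replacing one name.
[cite: McCallumLMS1991, §3 Cor. 3.2; §5 proof of Prop. 5.2] -/
theorem infinite_kolyvaginPrime_localization_fullOrder_pair_of_cmInert_socket (hCM : W.HasCM)
    (hin : Literature.NumberTheory.EllipticCurves.Rank1Residual.CMInert W 2)
    (hρ : W.HasSurjectiveModNGaloisRep 2) (hK : IsImaginaryQuadratic K)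
    (hH : SatisfiesHeegnerHypothesis (W.conductorNorm ℤ) K) (c : K ≃ₐ[ℚ] K) (hc : c ≠ 1)
    (M : ℕ) (hM : 1 ≤ M) (x y : galH1Torsion (W.baseChange K) ((2 ^ M : ℕ) : ℤ))
    {m κ : ℕ} (hm : 1 ≤ m) (hκ : 1 ≤ κ) (hx : addOrderOf x = 2 ^ m) (hy : addOrderOf y = 2 ^ κ)
    {sx sy : ℤ} (hsx : sx = 1 ∨ sx = -1) (hsy : sy = 1 ∨ sy = -1)
    (hτx : conjAct W c ((2 ^ M : ℕ) : ℤ) x = sx • x) (hτy : conjAct W c ((2 ^ M : ℕ) : ℤ) y = sy • y) :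
    Set.Infinite {ℓ : ℕ | FrobEqFrobInfty W K (2 ^ M) ℓ ∧
      Zhang2014.IsKolyvaginPrime (W.conductorNorm ℤ) W K 2 ℓ ∧ M ≤ Zhang2014.kolyvaginIndex W 2 ℓ ∧
      ∀ v : HeightOneSpectrum (𝓞 K), (ℓ : 𝓞 K) ∈ v.asIdeal →
        (∀ j : ℕ, ((2 ^ j : ℕ) : ℤ) • x ∈
            (W.baseChange K).torsionLocalKer (v.adicCompletion K) ((2 ^ M : ℕ) : ℤ) ↔ m ≤ j) ∧
        ∀ j : ℕ, ((2 ^ j : ℕ) : ℤ) • y ∈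
            (W.baseChange K).torsionLocalKer (v.adicCompletion K) ((2 ^ M : ℕ) : ℤ) ↔ κ ≤ j} :=
  (infinite_kolyvaginPrime_localization_fullOrder_pair_of_cmInert W K hCM hin hρ hK hH c hc M hM x y hm
    hκ hx hy hsx hsy hτx hτy).mono fun _ h ↦ ⟨h.1, h.2.1, h.2.2.1, h.2.2.2.2⟩

end Habitat

end Summit.BirchSwinnertonDyer.BirchSwinnertonDyer.Theorems.KolyvaginImageTwo

end
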